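import Mathlib
import HarnessLib
import Summits.NavierStokesRegularity.NavierStokesRegularity.Theorems.CompletionRelayChainPhaseIBlockField
import Summits.NavierStokesRegularity.NavierStokesRegularity.Theorems.TaylorModelRungThreeReadoutJets

/-!
# Route `CompletionRelayChain` — crux `RelayFrontStep` (stmt-NavierStokesRegularity-24850), K-side of `stub_phaseI`,
  work package K2(c)-ii: GENERIC ENCLOSURE ARITHMETIC — a bilinear field given by a coefficient list and its Cauchy
  (Taylor-jet) recursion, evaluated in ANY enclosure algebra, with ONE soundness proof; the rational-interval instance

The self-integrating Phase-I checker evaluates the relay block field (`bilinOfCoefs`, p618744) and its Taylor jets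
(`taylorJet`, `…ReadoutJets`) twice per step: in degree-2 Taylor models (the step map) and in plain intervals over the a
priori box (the Lagrange bound and the a priori test).  Both are instances of one abstract computation:
* `EncOps β` — the operations an enclosure algebra offers (`zero, add, mul, sq, sclI, divNat, post`), `EncSound o R` — their
  soundness w.r.t. a containment relation `R : β → ℝ → Prop` (`R a x`: "`a` encloses `x`");
* `evalField o l same U V c` — entrywise evaluation of the field with RATIONAL-INTERVAL coefficients `l` (entries
  `(c, a, b, lo, hi)` enclosing the real entries `(c, a, b, q)`, relation `Encl`), using the sign-keeping square `sq` for
  diagonal entries when both arguments are the same level (`same = true`); `evalField_sound`;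
* `jetLevels o l Y₀ K` — the memoised Cauchy recursion `Y_{k+1} = post((Σ_{m≤k} Q♯(Y_m, Y_{k−m}))/(k+1))`, levels
  materialised as vectors; `jet_sound`: level `k` encloses `taylorJet Q y k` coordinatewise whenever level `0` encloses `y`
  (port of `mem_jet_of_isJetEnclosure`, p616731, to an abstract relation);
* the instance `IV` (closed rational intervals with outward rounding to the dyadic grid `2^{-P}`), `ivOps`, `ivOps_sound`.
Folklore interval / Taylor-model arithmetic (Moore 1966 Ch. 3; Berz–Makino 1998 §2). MODEL-lattice bookkeeping (rung TL-M3-R64);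
nothing here is a statement about the Navier–Stokes equations.
-/

set_option linter.dupNamespace false

namespace Summit.NavierStokesRegularity.NavierStokesRegularity.Cruxes.RelayFrontStep.PhaseI

open scoped BigOperators
open Finset
open Summit.NavierStokesRegularity.NavierStokesRegularity.Theorems.TaylorModelReadout (taylorJet taylorJet_zero
  taylorJet_succ_apply)

/-! ### Enclosure algebras -/

/-- The operations of an enclosure algebra. [folklore] -/
structure EncOps (β : Type) where
  /-- encloses `0` -/
  zero : β
  /-- encloses sums -/
  add : β → β → β
  /-- encloses products -/
  mul : β → β → β
  /-- encloses squares -/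
  sq : β → β
  /-- encloses `c·x` for a real `c ∈ [lo, hi]` -/
  sclI : ℚ → ℚ → β → β
  /-- encloses `x / n` -/
  divNat : ℕ → β → β
  /-- post-processing (rounding / materialisation), encloses the same real -/
  post : β → β

/-- Soundness of an enclosure algebra w.r.t. the containment relation `R`. [folklore] -/
structure EncSound {β : Type} (o : EncOps β) (R : β → ℝ → Prop) : Prop where
  /-- `zero ∋ 0` -/
  zero : R o.zero 0
  /-- `add` -/
  add : ∀ a b x y, R a x → R b y → R (o.add a b) (x + y)
  /-- `mul` -/
  mul : ∀ a b x y, R a x → R b y → R (o.mul a b) (x * y)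
  /-- `sq` -/
  sq : ∀ a x, R a x → R (o.sq a) (x * x)
  /-- `sclI` -/
  sclI : ∀ (lo hi : ℚ) a (x c : ℝ), R a x → (lo : ℝ) ≤ c → c ≤ hi → R (o.sclI lo hi a) (c * x)
  /-- `divNat` -/
  divNat : ∀ (n : ℕ) a x, 0 < n → R a x → R (o.divNat n a) (x / n)
  /-- `post` -/
  post : ∀ a x, R a x → R (o.post a) x

variable {β : Type}

/-- Left-to-right sum `Σ_{m<k} f m` in the algebra. [folklore] -/
def sumR (o : EncOps β) (f : ℕ → β) : ℕ → β
  | 0 => o.zero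
  | k + 1 => o.add (sumR o f k) (f k)

/-- `sumR` encloses the real sum. [folklore] -/
theorem sumR_sound {o : EncOps β} {R : β → ℝ → Prop} (hS : EncSound o R) {f : ℕ → β} {g : ℕ → ℝ} :
    ∀ k, (∀ m < k, R (f m) (g m)) → R (sumR o f k) (∑ m ∈ Finset.range k, g m)
  | 0, _ => by simpa [sumR] using hS.zero
  | k + 1, h => by
    rw [Finset.sum_range_succ]
    exact hS.add _ _ _ _ (sumR_sound hS k fun m hm => h m (Nat.lt_succ_of_lt hm)) (h k (Nat.lt_succ_self k))

/-- Materialise a finite family into a vector-backed closure. [folklore] -/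
def materialize {n : ℕ} (f : Fin n → β) : Fin n → β :=
  let v : Vector β n := Vector.ofFn f
  fun i => v[i]

/-- `materialize f = f`. [folklore] -/
@[simp] theorem materialize_eq {n : ℕ} (f : Fin n → β) : materialize f = f := by
  funext i; simp [materialize, Fin.getElem_fin, Vector.getElem_ofFn]

/-! ### A bilinear field from an interval coefficient list -/

section Field

variable {ι : Type} [DecidableEq ι]

/-- The rational-interval coefficient list `lQ` (entries `(c, a, b, lo, hi)`) ENCLOSES the real coefficient list `lR`
(entries `(c, a, b, q)`): same indices, `q ∈ [lo, hi]`, entry by entry. [this file] -/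
def Encl (lQ : List (ι × ι × ι × ℚ × ℚ)) (lR : List (ι × ι × ι × ℝ)) : Prop :=
  List.Forall₂ (fun e f => e.1 = f.1 ∧ e.2.1 = f.2.1 ∧ e.2.2.1 = f.2.2.1 ∧
    (e.2.2.2.1 : ℝ) ≤ f.2.2.2 ∧ f.2.2.2 ≤ (e.2.2.2.2 : ℝ)) lQ lR

/-- Evaluation of component `c` of the field in the algebra: `Σ_{(c,a,b,[lo,hi])} [lo,hi]·(U_a·V_b)`, the product
replaced by the sign-keeping square when `same` and `a = b`. [this file] -/
def evalField (o : EncOps β) (l : List (ι × ι × ι × ℚ × ℚ)) (same : Bool) (U V : ι → β) (c : ι) : β :=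
  l.foldr (fun e acc =>
    if e.1 = c then
      o.add (o.sclI e.2.2.2.1 e.2.2.2.2
        (if same && decide (e.2.1 = e.2.2.1) then o.sq (U e.2.1) else o.mul (U e.2.1) (V e.2.2.1))) acc
    else acc) o.zero

omit [DecidableEq ι] in
/-- Head–tail formula of `bilinOfCoefs`. [folklore] -/
theorem bilinOfCoefs_cons [Fintype ι] [DecidableEq ι] (f : ι × ι × ι × ℝ) (l : List (ι × ι × ι × ℝ)) (u v : ι → ℝ) (c : ι) :
    bilinOfCoefs (f :: l) u v c = (if c = f.1 then f.2.2.2 * (u f.2.1 * v f.2.2.1) else 0) + bilinOfCoefs l u v c := by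
  rw [bilinOfCoefs_apply, bilinOfCoefs_apply, List.map_cons, List.sum_cons]

/-- **Soundness of `evalField`**: it encloses `bilinOfCoefs lR u v c` whenever `U, V` enclose `u, v` coordinatewise
(and `u = v` if the square shortcut is enabled). [this file] -/
theorem evalField_sound [Fintype ι] {o : EncOps β} {R : β → ℝ → Prop} (hS : EncSound o R)
    {lQ : List (ι × ι × ι × ℚ × ℚ)} {lR : List (ι × ι × ι × ℝ)} (hl : Encl lQ lR)
    {same : Bool} {U V : ι → β} {u v : ι → ℝ} (hU : ∀ a, R (U a) (u a)) (hV : ∀ b, R (V b) (v b))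
    (hsame : same = true → u = v) (c : ι) :
    R (evalField o lQ same U V c) (bilinOfCoefs lR u v c) := by
  induction hl with
  | nil =>
    simp only [evalField, List.foldr_nil]
    rw [bilinOfCoefs_apply]; simpa using hS.zero
  | @cons e f lQ lR hef _ ih =>
    obtain ⟨h1, h2, h3, hlo, hhi⟩ := hef
    rw [bilinOfCoefs_cons]
    simp only [evalField, List.foldr_cons] at ih ⊢
    by_cases hc : e.1 = c
    · rw [if_pos hc, if_pos (hc ▸ h1 ▸ rfl : c = f.1)]
      refine hS.add _ _ _ _ (hS.sclI _ _ _ _ _ ?_ hlo hhi) ih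
      rw [← h2, ← h3]
      by_cases hsq : (same && decide (e.2.1 = e.2.2.1)) = true
      · rw [if_pos hsq]
        obtain ⟨hs, hab⟩ := Bool.and_eq_true_iff.1 hsq
        have hab' : e.2.1 = e.2.2.1 := of_decide_eq_true hab
        rw [← hab', ← hsame hs]
        exact hS.sq _ _ (hU _)
      · rw [if_neg hsq]
        exact hS.mul _ _ _ _ (hU _) (hV _)
    · have hc' : ¬ c = f.1 := fun h => hc (h1.trans h.symm)
      rw [if_neg hc, if_neg hc', zero_add]
      exact ih

end Field

/-! ### Memoised Cauchy (Taylor-jet) recursion -/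

section Jets

variable {n : ℕ}

/-- Total array read with default. [folklore] -/
def aget (A : Array (Fin n → β)) (k : ℕ) (Y0 : Fin n → β) : Fin n → β := if h : k < A.size then A[k] else Y0

/-- Reading below the old size ignores a push. [folklore] -/
theorem aget_push_lt {A : Array (Fin n → β)} {x Y0 : Fin n → β} {k : ℕ} (hk : k < A.size) :
    aget (A.push x) k Y0 = aget A k Y0 := by
  unfold aget
  rw [dif_pos (by rw [Array.size_push]; omega), dif_pos hk, Array.getElem_push_lt]

/-- Reading at the old size returns the pushed entry. [folklore] -/
theorem aget_push_eq {A : Array (Fin n → β)} {x Y0 : Fin n → β} : aget (A.push x) A.size Y0 = x := by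
  unfold aget
  rw [dif_pos (by rw [Array.size_push]; omega), Array.getElem_push_eq]

/-- Level `k+1` from the array `A = #[Y_0, …, Y_k]`: `post((Σ_{m≤k} Q♯(Y_m, Y_{k−m}))/(k+1))`, materialised. [this file] -/
def jetNext (o : EncOps β) (l : List (Fin n × Fin n × Fin n × ℚ × ℚ)) (Y0 : Fin n → β)
    (A : Array (Fin n → β)) : Fin n → β :=
  let k := A.size - 1
  materialize fun c => o.post (o.divNat (k + 1)
    (sumR o (fun m => evalField o l (m == k - m) (aget A m Y0) (aget A (k - m) Y0) c) (k + 1)))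

/-- The levels `#[Y_0, …, Y_K]` of the recursion. [this file] -/
def jetLevels (o : EncOps β) (l : List (Fin n × Fin n × Fin n × ℚ × ℚ)) (Y0 : Fin n → β) : ℕ → Array (Fin n → β)
  | 0 => #[Y0]
  | K + 1 => let A := jetLevels o l Y0 K; A.push (jetNext o l Y0 A)

/-- Level `k` (read with default `Y0`). [this file] -/
def jet (o : EncOps β) (l : List (Fin n × Fin n × Fin n × ℚ × ℚ)) (Y0 : Fin n → β) (K k : ℕ) : Fin n → β :=
  aget (jetLevels o l Y0 K) k Y0

variable (o : EncOps β) (l : List (Fin n × Fin n × Fin n × ℚ × ℚ)) (Y0 : Fin n → β)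

/-- `jetLevels K` has `K+1` entries. [this file] -/
theorem size_jetLevels : ∀ K, (jetLevels o l Y0 K).size = K + 1
  | 0 => rfl
  | K + 1 => by simp [jetLevels, size_jetLevels K]

/-- Levels are stable: level `k ≤ K` of `jetLevels K` is level `k` of `jetLevels k`. [this file] -/
theorem jet_of_le : ∀ {K k : ℕ}, k ≤ K → jet o l Y0 K k = jet o l Y0 k k
  | 0, k, hk => by obtain rfl := Nat.le_zero.1 hk; rfl
  | K + 1, k, hk => by
    rcases Nat.lt_or_eq_of_le hk with hlt | rfl
    · have hkK : k ≤ K := Nat.lt_succ_iff.1 hlt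
      rw [← jet_of_le hkK]
      unfold jet
      simp only [jetLevels]
      exact aget_push_lt (by rw [size_jetLevels]; exact hlt)
    · rfl

/-- Level `0` is `Y0`. [this file] -/
theorem jet_zero (K : ℕ) : jet o l Y0 K 0 = Y0 := by
  rw [jet_of_le o l Y0 (Nat.zero_le K)]; rfl

/-- The recursion at level `k+1`. [this file] -/
theorem jet_succ (k : ℕ) (c : Fin n) :
    jet o l Y0 (k + 1) (k + 1) c = o.post (o.divNat (k + 1)
      (sumR o (fun m => evalField o l (m == k - m) (jet o l Y0 k m) (jet o l Y0 k (k - m)) c) (k + 1))) := by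
  unfold jet
  simp only [jetLevels]
  have h := @aget_push_eq β n (jetLevels o l Y0 k) (jetNext o l Y0 (jetLevels o l Y0 k)) Y0
  rw [size_jetLevels] at h
  rw [h]
  simp only [jetNext, size_jetLevels, Nat.add_sub_cancel, materialize_eq]

/-- **Soundness of the memoised recursion**: if level `0` encloses `y` coordinatewise then, for every `k ≤ K`, level `k`
encloses the Taylor jet `taylorJet Q y k` of the field `Q = bilinOfCoefs lR` coordinatewise. [this file; folklore: Moore
1966 Ch. 3 (inclusion property applied to the Cauchy-product recursion)] -/
theorem jet_sound {o : EncOps β} {R : β → ℝ → Prop} (hS : EncSound o R)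
    {lQ : List (Fin n × Fin n × Fin n × ℚ × ℚ)} {lR : List (Fin n × Fin n × Fin n × ℝ)} (hl : Encl lQ lR)
    {Y0 : Fin n → β} {y : Fin n → ℝ} (h0 : ∀ c, R (Y0 c) (y c)) :
    ∀ K k, k ≤ K → ∀ c, R (jet o lQ Y0 K k c) (taylorJet (fun u v => bilinOfCoefs lR u v) y k c) := by
  intro K k
  induction k using Nat.strong_induction_on generalizing K with
  | _ k ih =>
    intro hk c
    cases k with
    | zero => rw [jet_zero]; simpa using h0 c
    | succ k =>
      rw [jet_of_le o lQ Y0 hk, jet_succ]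
      have hrec : taylorJet (fun u v => bilinOfCoefs lR u v) y (k + 1) c =
          (∑ m ∈ Finset.range (k + 1), bilinOfCoefs lR (taylorJet (fun u v => bilinOfCoefs lR u v) y m)
            (taylorJet (fun u v => bilinOfCoefs lR u v) y (k - m)) c) / ((k + 1 : ℕ) : ℝ) := by
        rw [eq_div_iff (by positivity), ← taylorJet_succ_apply]; push_cast; ring
      rw [hrec]
      refine hS.post _ _ (hS.divNat _ _ _ (Nat.succ_pos k) (sumR_sound hS (k + 1) fun m hm => ?_))
      have hmk : m ≤ k := Nat.le_of_lt_succ hm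
      refine evalField_sound hS hl (fun a => ih m (Nat.lt_succ_of_le hmk) k hmk a)
        (fun b => ih (k - m) (Nat.lt_succ_of_le (Nat.sub_le k m)) k (Nat.sub_le k m) b) (fun hs => ?_) c
      have : m = k - m := by simpa using hs
      rw [← this]

end Jets

/-! ### The rational-interval instance -/

/-- A closed rational interval. [folklore] -/
structure IV where
  /-- lower end -/
  lo : ℚ
  /-- upper end -/
  hi : ℚ

namespace IV

/-- `I` contains `x`. [folklore] -/
def mem (I : IV) (x : ℝ) : Prop := (I.lo : ℝ) ≤ x ∧ x ≤ (I.hi : ℝ)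
/-- Round down to the grid `2^{-P}`. [folklore] -/
def rdn (P : ℕ) (x : ℚ) : ℚ := (⌊x * 2 ^ P⌋ : ℚ) / 2 ^ P
/-- Round up to the grid `2^{-P}`. [folklore] -/
def rup (P : ℕ) (x : ℚ) : ℚ := -rdn P (-x)
/-- `rdn P x ≤ x`. [folklore] -/
theorem rdn_le (P : ℕ) (x : ℚ) : rdn P x ≤ x := by
  unfold rdn; rw [div_le_iff₀ (by positivity)]; exact Int.floor_le _

/-- `x ≤ rup P x`. [folklore] -/
theorem le_rup (P : ℕ) (x : ℚ) : x ≤ rup P x := by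
  unfold rup; have := rdn_le P (-x); linarith
/-- Outward rounding. [folklore] -/
def roundOut (P : ℕ) (I : IV) : IV := ⟨rdn P I.lo, rup P I.hi⟩
/-- The point interval. [folklore] -/
def pt (a : ℚ) : IV := ⟨a, a⟩
/-- Sum. [folklore] -/
def add (I J : IV) : IV := ⟨I.lo + J.lo, I.hi + J.hi⟩
/-- Product (four corners). [folklore] -/
def mul (I J : IV) : IV :=
  ⟨min (min (I.lo * J.lo) (I.lo * J.hi)) (min (I.hi * J.lo) (I.hi * J.hi)),
   max (max (I.lo * J.lo) (I.lo * J.hi)) (max (I.hi * J.lo) (I.hi * J.hi))⟩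
/-- Sign-keeping square. [folklore] -/
def sq (I : IV) : IV :=
  ⟨if I.lo ≤ 0 ∧ 0 ≤ I.hi then 0 else min (I.lo * I.lo) (I.hi * I.hi), max (I.lo * I.lo) (I.hi * I.hi)⟩
/-- Division by a natural number. [folklore] -/
def divNat (n : ℕ) (I : IV) : IV := ⟨I.lo / n, I.hi / n⟩
/-- Magnitude `max(|lo|, |hi|)`. [folklore] -/
def mag (I : IV) : ℚ := max |I.lo| |I.hi|
/-- The point interval contains its point. [folklore] -/
theorem mem_pt (a : ℚ) : (pt a).mem a := ⟨le_rfl, le_rfl⟩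
/-- Outward rounding keeps membership. [folklore] -/
theorem mem_roundOut (P : ℕ) {I : IV} {x : ℝ} (h : I.mem x) : (I.roundOut P).mem x :=
  ⟨le_trans (by exact_mod_cast rdn_le P I.lo) h.1, le_trans h.2 (by exact_mod_cast le_rup P I.hi)⟩
/-- Soundness of `add`. [folklore] -/
theorem mem_add {I J : IV} {x y : ℝ} (hx : I.mem x) (hy : J.mem y) : (I.add J).mem (x + y) := by
  obtain ⟨h1, h2⟩ := hx; obtain ⟨h3, h4⟩ := hy
  constructor <;> simp only [add] <;> push_cast <;> linarith
/-- A product with the left factor in an interval lies between the products at the ends. [folklore] -/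
theorem mul_mem_ends {a b x : ℝ} (y : ℝ) (ha : a ≤ x) (hb : x ≤ b) :
    min (a * y) (b * y) ≤ x * y ∧ x * y ≤ max (a * y) (b * y) := by
  rcases le_or_gt 0 y with hy | hy
  · exact ⟨(min_le_left _ _).trans (mul_le_mul_of_nonneg_right ha hy),
      (mul_le_mul_of_nonneg_right hb hy).trans (le_max_right _ _)⟩
  · exact ⟨(min_le_right _ _).trans (mul_le_mul_of_nonpos_right hb hy.le),
      (mul_le_mul_of_nonpos_right ha hy.le).trans (le_max_left _ _)⟩
/-- A product with the right factor in an interval lies between the products at the ends. [folklore] -/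
theorem mul_mem_ends' {a b y : ℝ} (e : ℝ) (ha : a ≤ y) (hb : y ≤ b) :
    min (e * a) (e * b) ≤ e * y ∧ e * y ≤ max (e * a) (e * b) := by
  have h := mul_mem_ends e ha hb
  simpa only [mul_comm] using h

/-- Soundness of `mul`. [folklore] -/
theorem mem_mul {I J : IV} {x y : ℝ} (hx : I.mem x) (hy : J.mem y) : (I.mul J).mem (x * y) := by
  obtain ⟨h1, h2⟩ := hx; obtain ⟨h3, h4⟩ := hy
  have hA := mul_mem_ends' (I.lo : ℝ) h3 h4
  have hB := mul_mem_ends' (I.hi : ℝ) h3 h4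
  have hC := mul_mem_ends y h1 h2
  simp only [mem, mul]; push_cast
  exact ⟨(min_le_min hA.1 hB.1).trans hC.1, hC.2.trans (max_le_max hA.2 hB.2)⟩
/-- Soundness of `sq`. [folklore] -/
theorem mem_sq {I : IV} {x : ℝ} (hx : I.mem x) : (I.sq).mem (x * x) := by
  obtain ⟨h1, h2⟩ := hx
  simp only [mem, sq]
  constructor
  · split_ifs with h
    · push_cast; exact mul_self_nonneg x
    · push_cast
      rw [not_and_or] at h
      rcases h with h | h
      · push Not at h
        have hlo : (0:ℝ) < I.lo := by exact_mod_cast h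
        exact (min_le_left _ _).trans (mul_self_le_mul_self hlo.le h1)
      · push Not at h
        have hhi : (I.hi : ℝ) < 0 := by exact_mod_cast h
        refine (min_le_right _ _).trans ?_
        have := mul_self_le_mul_self (neg_nonneg.2 hhi.le) (neg_le_neg h2)
        simpa using this
  · push_cast
    rcases le_or_gt 0 x with h0 | h0
    · exact (mul_self_le_mul_self h0 h2).trans (le_max_right _ _)
    · refine le_trans ?_ (le_max_left _ _)
      have := mul_self_le_mul_self (neg_nonneg.2 h0.le) (neg_le_neg h1)
      simpa using this

/-- Soundness of `divNat`. [folklore] -/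
theorem mem_divNat {n : ℕ} (hn : 0 < n) {I : IV} {x : ℝ} (hx : I.mem x) : (I.divNat n).mem (x / n) := by
  obtain ⟨h1, h2⟩ := hx
  have hn' : (0 : ℝ) < n := by exact_mod_cast hn
  simp only [mem, divNat]; push_cast
  exact ⟨div_le_div_of_nonneg_right h1 hn'.le, div_le_div_of_nonneg_right h2 hn'.le⟩
/-- A member is bounded by the magnitude. [folklore] -/
theorem abs_le_mag {I : IV} {x : ℝ} (hx : I.mem x) : |x| ≤ (I.mag : ℝ) := by
  obtain ⟨h1, h2⟩ := hx
  simp only [mag]; push_cast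
  rw [abs_le]; constructor
  · have : |(I.lo : ℝ)| ≤ max |(I.lo : ℝ)| |(I.hi : ℝ)| := le_max_left _ _
    linarith [neg_abs_le (I.lo : ℝ)]
  · have : |(I.hi : ℝ)| ≤ max |(I.lo : ℝ)| |(I.hi : ℝ)| := le_max_right _ _
    linarith [le_abs_self (I.hi : ℝ)]
end IV

/-- The rational-interval enclosure algebra (outward rounding to `2^{-P}` after `mul/sq/sclI/divNat`). [this file] -/
def ivOps (P : ℕ) : EncOps IV where
  zero := IV.pt 0
  add := IV.add
  mul I J := (I.mul J).roundOut P
  sq I := (I.sq).roundOut P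
  sclI lo hi I := ((IV.mk lo hi).mul I).roundOut P
  divNat n I := (I.divNat n).roundOut P
  post := id

/-- **Soundness of the interval algebra.** [folklore] -/
theorem ivOps_sound (P : ℕ) : EncSound (ivOps P) IV.mem where
  zero := by show (IV.pt 0).mem 0; simpa using IV.mem_pt 0
  add := fun _ _ _ _ hx hy => IV.mem_add hx hy
  mul := fun _ _ _ _ hx hy => IV.mem_roundOut P (IV.mem_mul hx hy)
  sq := fun _ _ hx => IV.mem_roundOut P (IV.mem_sq hx)
  sclI := fun lo hi _ _ _ hx hlo hhi => IV.mem_roundOut P (IV.mem_mul ⟨hlo, hhi⟩ hx)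
  divNat := fun _ _ _ hn hx => IV.mem_roundOut P (IV.mem_divNat hn hx)
  post := fun _ _ hx => hx


end Summit.NavierStokesRegularity.NavierStokesRegularity.Cruxes.RelayFrontStep.PhaseI
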